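import Summits.Ventures.PercRepro.TripleGrouping
import Summits.Ventures.PercRepro.CubicForm
import Summits.Ventures.PercRepro.SMC3Proof

/-!
# Lemma C and the reduction of C-007 to it

**C-007** (`Summits.Ventures.PercRepro.Conjectures`): for three marked vertices with partition
law `(x, y₁, y₂, y₃, z)` (rows `abc, ab|c, ac|b, bc|a, a|b|c`),
`(x + z) · (x z − y₁y₂ − y₁y₃ − y₂y₃) ≥ y₁ y₂ y₃`.

Three independent copies `ω₁, ω₂, ω₃` of the configuration, sorted edge by edge into
`u = ω₁ ⊔ ω₂ ⊔ ω₃ ≥ m = median ≥ v = ω₁ ⊓ ω₂ ⊓ ω₃`, have the same product weight as the sorted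
triple (`weight_mul_weight_mul_weight_eq_sorted`), and the triples of a class `(u, m, v)` are the
`3^{|u ∖ v|}` colourings `φ : u ∖ v → {0, 1, 2}` (`sum_tripleClass_eq_sum_colourings`).  Hence
(`cubSum_law_eq_sum_tripleClass`, the **three-copy sorting identity**)

  `6 · [(x + z)(xz − e₂(y)) − y₁y₂y₃] = ∑_{v ≤ m ≤ u} w(u) w(m) w(v) · Z₃(u, m, v)`,

where `Z₃(u, m, v) = ∑_φ c007Kernel (cell ω₁) (cell ω₂) (cell ω₃)` counts the colourings of the
class by the multiset of their three cells with the kernel `+2` on `{⊤,⊤,⊥}` and `{⊤,⊥,⊥}`,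
`−1` on `{⊤,x_i,x_j}`, `{⊥,x_i,x_j}` (`i ≠ j`) and `{x₁,x₂,x₃}`, `0` otherwise
(`cubSum_c007Kernel`: the `3!` orderings of a multiset are inside the kernel's symmetry).

**Lemma C** (`LemmaC`, conjectured; census 976,688 graph classes + 1,187,664 abstract
(map, split) pairs at `|u ∖ v| ≤ 4` with no violation, `proofs/P5-C007-lemmaC.md`):
`Z₃(u, m, v) ≥ 0` for every class of every marked graph.  `C007_of_LemmaC` is the reduction.
The machinery is generic in the cell statistic and the kernel (`cubSum_law_nonneg_of_classes`),
so the same file serves the `k = 4` analogue C-008 with the two-block cells.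
-/

namespace PercRepro

open Finset

variable {E : Type*} [Fintype E] [DecidableEq E]

/-! ### The law of a statistic and the cubic form of three copies -/

/-- The law of a statistic: `∑_ω w(ω) g(cell ω) = ∑_s P(cell = s) g(s)`. -/
theorem sum_weight_mul_comp_lc {ι : Type*} [Fintype ι] [DecidableEq ι] (p : E → ℝ)
    (cell : Config E → ι) (g : ι → ℝ) :
    ∑ a, weight p a * g (cell a) = ∑ s, prob p (cell ⁻¹' {s}) * g s := by
  rw [← Finset.sum_fiberwise (univ : Finset (Config E)) cell (fun a => weight p a * g (cell a))]
  refine Finset.sum_congr rfl fun s _ => ?_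
  unfold prob
  rw [Finset.sum_mul, Finset.sum_filter]
  refine Finset.sum_congr rfl fun a _ => ?_
  by_cases h : cell a = s
  · simp [h]
  · simp [h]

/-- The expectation of a kernel of three independent copies is the cubic form of the law. -/
theorem sum3_weight_mul_comp {ι : Type*} [Fintype ι] [DecidableEq ι] (p : E → ℝ)
    (cell : Config E → ι) (K : ι → ι → ι → ℝ) :
    ∑ a, ∑ b, ∑ c, weight p a * weight p b * weight p c * K (cell a) (cell b) (cell c) =
      cubSum K (fun s => prob p (cell ⁻¹' {s})) := by
  unfold cubSum triSum
  have h3 : ∀ a b, (∑ c, weight p a * weight p b * weight p c * K (cell a) (cell b) (cell c)) =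
      weight p a * weight p b * ∑ w, prob p (cell ⁻¹' {w}) * K (cell a) (cell b) w := by
    intro a b
    rw [← sum_weight_mul_comp_lc p cell (fun w => K (cell a) (cell b) w), Finset.mul_sum]
    refine Finset.sum_congr rfl fun c _ => ?_
    ring
  have h2 : ∀ a, (∑ b, weight p a * weight p b *
      ∑ w, prob p (cell ⁻¹' {w}) * K (cell a) (cell b) w) =
      weight p a * ∑ t, prob p (cell ⁻¹' {t}) * ∑ w, prob p (cell ⁻¹' {w}) * K (cell a) t w := by
    intro a
    rw [← sum_weight_mul_comp_lc p cell
      (fun t => ∑ w, prob p (cell ⁻¹' {w}) * K (cell a) t w), Finset.mul_sum]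
    refine Finset.sum_congr rfl fun b _ => ?_
    ring
  simp only [h3, h2]
  refine (sum_weight_mul_comp_lc p cell
    (fun s => ∑ t, prob p (cell ⁻¹' {t}) * ∑ w, prob p (cell ⁻¹' {w}) * K s t w)).trans ?_
  refine Finset.sum_congr rfl fun a _ => ?_
  rw [Finset.mul_sum]
  refine Finset.sum_congr rfl fun t _ => ?_
  rw [Finset.mul_sum, Finset.mul_sum]
  refine Finset.sum_congr rfl fun w _ => ?_
  ring

/-- **The three-copy sorting identity for a cubic form of the law**:
`cubSum K (law) = ∑_{u, m, v} w(u) w(m) w(v) · ∑_{(ω₁,ω₂,ω₃) ∈ class(u,m,v)} K (cell ω₁) (cell ω₂) (cell ω₃)`. -/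
theorem cubSum_law_eq_sum_tripleClass {ι : Type*} [Fintype ι] [DecidableEq ι] (p : E → ℝ)
    (cell : Config E → ι) (K : ι → ι → ι → ℝ) :
    cubSum K (fun s => prob p (cell ⁻¹' {s})) =
      ∑ u, ∑ m, ∑ v, weight p u * weight p m * weight p v *
        ∑ x ∈ tripleClass u m v, K (cell x.1) (cell x.2.1) (cell x.2.2) := by
  rw [← sum3_weight_mul_comp, sum_weight3_mul_eq_sum_tripleClass p
    (fun a b c => K (cell a) (cell b) (cell c))]

/-- If every class sum is nonnegative, the cubic form of the law is nonnegative. -/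
theorem cubSum_law_nonneg_of_classes {ι : Type*} [Fintype ι] [DecidableEq ι] {p : E → ℝ}
    (hp : IsProb p) (cell : Config E → ι) (K : ι → ι → ι → ℝ)
    (h : ∀ u m v : Config E, 0 ≤ ∑ x ∈ tripleClass u m v, K (cell x.1) (cell x.2.1) (cell x.2.2)) :
    0 ≤ cubSum K (fun s => prob p (cell ⁻¹' {s})) := by
  rw [cubSum_law_eq_sum_tripleClass]
  refine Finset.sum_nonneg fun u _ => Finset.sum_nonneg fun m _ => Finset.sum_nonneg fun v _ => ?_
  exact mul_nonneg (mul_nonneg (mul_nonneg (weight_nonneg hp u) (weight_nonneg hp m))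
    (weight_nonneg hp v)) (h u m v)

namespace MultiGraph

variable {V : Type*} (G : MultiGraph V E)

/-! ### The cell of a configuration (three marked vertices) -/

open Classical in
/-- The cell of `ω` for the marked vertices `a, b, c`, in the row order of `triEvent`:
`0 = abc`, `1 = ab|c`, `2 = ac|b`, `3 = bc|a`, `4 = a|b|c`. -/
noncomputable def triCell (a b c : V) (ω : Config E) : Fin 5 :=
  if G.Conn ω a b ∧ G.Conn ω b c then 0 else if G.Conn ω a b then 1 else if G.Conn ω a c then 2
    else if G.Conn ω b c then 3 else 4

omit [Fintype E] [DecidableEq E] in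
/-- The five events are the fibres of `triCell`. -/
theorem mem_triEvent_iff_triCell (a b c : V) (ω : Config E) (s : Fin 5) :
    ω ∈ G.triEvent a b c s ↔ G.triCell a b c ω = s := by
  have t1 : G.Conn ω a b → G.Conn ω b c → G.Conn ω a c := fun h h' => h.trans h'
  have t2 : G.Conn ω a b → G.Conn ω a c → G.Conn ω b c := fun h h' => h.symm.trans h'
  have t3 : G.Conn ω a c → G.Conn ω b c → G.Conn ω a b := fun h h' => h.trans h'.symm
  unfold triCell
  fin_cases s <;> simp only [triEvent] <;>
    split_ifs with h1 h2 h3 h4 <;> simp [Matrix.cons_val] <;> tauto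

/-- The law of `triCell` is the law vector `triLaw`. -/
theorem prob_triCell_preimage (p : E → ℝ) (a b c : V) (s : Fin 5) :
    prob p (G.triCell a b c ⁻¹' {s}) = G.triLaw p a b c s := by
  unfold triLaw
  congr 1
  ext ω
  rw [Set.mem_preimage, Set.mem_singleton_iff, mem_triEvent_iff_triCell]

end MultiGraph

/-! ### The C-007 kernel -/

/-- The symmetric kernel of `6 · [(x + z)(xz − e₂(y)) − y₁y₂y₃]` on the cells
`0 = abc, 1 = ab|c, 2 = ac|b, 3 = bc|a, 4 = a|b|c`: `2` on the multisets `{0,0,4}`, `{0,4,4}`,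
`−1` on `{0,i,j}`, `{4,i,j}` (`i ≠ j ∈ {1,2,3}`) and `{1,2,3}`, `0` otherwise. -/
def c007Kernel : Fin 5 → Fin 5 → Fin 5 → ℝ :=
  ![![![0, 0, 0, 0, 2], ![0, 0, -1, -1, 0], ![0, -1, 0, -1, 0], ![0, -1, -1, 0, 0], ![2, 0, 0, 0, 2]],
    ![![0, 0, -1, -1, 0], ![0, 0, 0, 0, 0], ![-1, 0, 0, -1, -1], ![-1, 0, -1, 0, -1], ![0, 0, -1, -1, 0]],
    ![![0, -1, 0, -1, 0], ![-1, 0, 0, -1, -1], ![0, 0, 0, 0, 0], ![-1, -1, 0, 0, -1], ![0, -1, 0, -1, 0]],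
    ![![0, -1, -1, 0, 0], ![-1, 0, -1, 0, -1], ![-1, -1, 0, 0, -1], ![0, 0, 0, 0, 0], ![0, -1, -1, 0, 0]],
    ![![2, 0, 0, 0, 2], ![0, 0, -1, -1, 0], ![0, -1, 0, -1, 0], ![0, -1, -1, 0, 0], ![2, 0, 0, 0, 0]]]

/-- The cubic form of the C-007 kernel is `6 · [(x + z)(xz − e₂(y)) − y₁y₂y₃]`. -/
theorem cubSum_c007Kernel (π : Fin 5 → ℝ) :
    cubSum c007Kernel π =
      6 * ((π 0 + π 4) * (π 0 * π 4 - (π 1 * π 2 + π 1 * π 3 + π 2 * π 3)) - π 1 * π 2 * π 3) := by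
  simp only [cubSum, triSum, Fin.sum_univ_five, c007Kernel]
  simp [Matrix.cons_val]
  ring

/-- The class sum of the C-007 kernel: `Z₃(u, m, v)`. -/
noncomputable def c007ClassSum {V : Type*} (G : MultiGraph V E) (a b c : V) (u m v : Config E) :
    ℝ :=
  ∑ x ∈ tripleClass u m v,
    c007Kernel (G.triCell a b c x.1) (G.triCell a b c x.2.1) (G.triCell a b c x.2.2)

/-- **Lemma C** (conjectured): for every marked multigraph and every nested triple
`v ≤ m ≤ u`, the colourings `φ : u ∖ v → {0,1,2}` of the class weighted by the C-007 kernel of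
the three cells sum to a nonnegative number. -/
def LemmaC : Prop :=
  ∀ {V E : Type} [Fintype E] [DecidableEq E] (G : MultiGraph V E) (a b c : V)
    (u m v : Config E), v ≤ m → m ≤ u →
      0 ≤ ∑ φ : ↥(openEdges u \ openEdges v) → Fin 3,
        c007Kernel (G.triCell a b c (tripleCopy v m (openEdges u \ openEdges v) φ 0))
          (G.triCell a b c (tripleCopy v m (openEdges u \ openEdges v) φ 1))
          (G.triCell a b c (tripleCopy v m (openEdges u \ openEdges v) φ 2))

/-- Under Lemma C every class sum is nonnegative (non-nested triples have empty classes). -/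
theorem c007ClassSum_nonneg_of_lemmaC (h : LemmaC) {V E : Type} [Fintype E] [DecidableEq E]
    (G : MultiGraph V E) (a b c : V) (u m v : Config E) : 0 ≤ c007ClassSum G a b c u m v := by
  unfold c007ClassSum
  by_cases hn : v ≤ m ∧ m ≤ u
  · have h' := sum_tripleClass_eq_sum_colourings hn.1 hn.2
      (fun x y z => c007Kernel (G.triCell a b c x) (G.triCell a b c y) (G.triCell a b c z))
    rw [h']
    exact h G a b c u m v hn.1 hn.2
  · rw [tripleClass_eq_empty_of_not_le hn, Finset.sum_empty]

/-- **C-007 follows from Lemma C** (the three-copy sorting identity). -/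
theorem C007_of_LemmaC (h : LemmaC) : C007 := by
  intro V E _ _ G p hp a b c
  have key := cubSum_law_nonneg_of_classes hp (G.triCell a b c) c007Kernel
    (fun u m v => c007ClassSum_nonneg_of_lemmaC h G a b c u m v)
  rw [cubSum_c007Kernel] at key
  simp only [MultiGraph.prob_triCell_preimage, ← MultiGraph.law3_eq_triLaw] at key
  rw [← MultiGraph.law3_zero, ← MultiGraph.law3_one, ← MultiGraph.law3_two,
    ← MultiGraph.law3_three, ← MultiGraph.law3_four]
  nlinarith [key]

end PercRepro
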